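import Summits.HodgeConjecture.HodgeConjecture.Theorems.LimitExtensionSpecialisationOfAlgebraicity
import Summits.HodgeConjecture.HodgeConjecture.Theorems.LimitExtensionSpecialisationOfAlgebraicityLimit
import Literature.AlgebraicGeometry.HodgeTheory.AlgebraicityLocusCurves
import Literature.AlgebraicGeometry.Morphisms.SmoothOfFlatFibre
import Literature.AlgebraicGeometry.Motives.SmoothPiecesByDimension

/-!
# Route LimitExtension — `SpecialisationOfAlgebraicity` (item stmt-HodgeConjecture-2998) from SPREAD alone

The support item `SpecialisationOfAlgebraicity` (specialisation of algebraicity modulo coniveau one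
along a one-parameter degeneration) proved MODULO ONE classical ingredient, SPREAD — spreading of
algebraic supports along the family: relative Hilbert/Chow schemes, countability and flat limits
over the smooth curve give one Zariski-closed `𝒵 ⊆ W` off whose slices all the algebraic classes
`B_t`, `t ≠ t₀`, die, with slice over `t₀` of codimension `≥ k` (Voisin II §3.3.1, §7.3.2; Fulton
1998 §10.1; the same input that the tree's named fact
`HodgeTheory.charlesSchnell_algebraicityLocus_iUnion_closed` awaits). Everything else is proved:

* `mem_smoothLocus_of_isOpenImmersion_fiberOver` — **fibre criterion** (EGA IV₄ 17.5.1, through the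
  tree's `Morphisms.mem_smoothLocus_of_flat_stalkMap_of_smooth_fiber`): the points of a smooth open
  piece of the fibre of a flat `f` over a complex point lie in the smooth locus of `f` (the fibre
  `W ×_T Spec ℂ` over `t₀` is identified with Mathlib's `f.fiber (pt t₀)` through `κ(pt t₀) ≅ ℂ`,
  and off the closed `W_{t₀} ∖ φ(Vx)` the whole fibre is the smooth `φ(Vx) ≅ Vx`).
* `exists_smoothOfRelativeDimension_of_mem_smoothLocus` — about a point of its smooth locus a
  morphism locally of finite presentation is smooth of some fixed relative dimension on an open
  neighbourhood (one standard smooth chart serves all its points).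
* `specialisationOfAlgebraicity_of_spread` — **the item from SPREAD**: shrink the open piece of `X`
  into one such chart, apply the `limit` theorem `restrictCompl_map_eq_zero_of_forall_ne`, use the
  codimension clause (`k ≥ 1`) to see that the support misses the generic point, and conclude by the
  coniveau bookkeeping `mem_supportedClasses_one_of_restrictCompl_map_eq_zero`.
-/

noncomputable section

-- `Summit.HodgeConjecture.HodgeConjecture.Theorems` is the mandated namespace (single-conjunct summit:
-- Sub = Summit), which `linter.dupNamespace` flags on every declaration; the lakefile turns the
-- linter off tree-wide (weak option), restated here so stand-alone elaboration is warning-free too.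
set_option linter.dupNamespace false

open scoped Topology
open Set Function Filter

namespace Summit.HodgeConjecture.HodgeConjecture.Theorems

/-! ### The fibre criterion at the smooth open piece of the special fibre -/

section FibreCriterion

open CategoryTheory CategoryTheory.Limits AlgebraicGeometry
open Literature.AlgebraicGeometry.Motives

/-- **The points of a smooth open piece of a fibre lie in the smooth locus** (fibre criterion of
smoothness, EGA IV₄ 17.5.1, through the tree's pointwise form
`Morphisms.mem_smoothLocus_of_flat_stalkMap_of_smooth_fiber`). Let `f : W ⟶ T` be flat and locally
of finite presentation over a `ℂ`-scheme `T` locally of finite type, `t₀ ∈ T(ℂ)`, and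
`φ : Vx ⟶ W_{t₀}` an open immersion into the fibre from a `ℂ`-scheme `Vx` smooth over `ℂ`. Then
every point of `φ(Vx) ⊆ W` lies in the smooth locus of `f`. Proof: remove from `W` the closed set
`W_{t₀} ∖ φ(Vx)`; over the residue field `κ(t₀) ≅ ℂ` the fibre of the remaining open `U₀ → T` at
`t₀` is `φ(Vx) ≅ Vx`, smooth; flatness is inherited, and the pointwise fibre criterion applies.
[cite: EGAIV4, Thm. 17.5.1] [cite: StacksProject, Tag 01V8] -/
theorem mem_smoothLocus_of_isOpenImmersion_fiberOver {Vx T W : SchemeOver ℂ} (f : W ⟶ T)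
    [LocallyOfFinitePresentation f.left] [Flat f.left] [LocallyOfFiniteType T.hom]
    (t₀ : ComplexPoints T) (φ : Vx ⟶ fiberOver f t₀) [IsOpenImmersion φ.left] [Smooth Vx.hom]
    (v : Vx.left) : (φ ≫ fiberι f t₀).left.base v ∈ f.left.smoothLocus := by
  -- notation: the fibre `F = W ×_T Spec ℂ` over `t₀` and Mathlib's fibre `Y = W ×_T Spec κ(y₀)`
  set y₀ : T.left := t₀.pt with hy₀
  set ι : (fiberOver f t₀).left ⟶ W.left := (fiberι f t₀).left with hι
  set σ : (fiberOver f t₀).left ⟶ (specOver ℂ ℂ).left := (fiberOverToSpec f t₀).left with hσ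
  have hισ : ι ≫ f.left = σ ≫ t₀.left := congrArg CommaMorphism.left (fiberι_comp f t₀)
  haveI : IsClosedImmersion ι := isClosedImmersion_fiberι_left f t₀
  set h : Spec (T.left.residueField y₀) ⟶ T.left := T.left.fromSpecResidueField y₀ with hh
  -- `Spec ℂ ≅ Spec κ(y₀)` (Nullstellensatz) with `eI.hom ≫ h = t₀`
  set eI : (specOver ℂ ℂ).left ≅ Spec (T.left.residueField y₀) :=
    (Scheme.Spec.mapIso (residueFieldIsoBase T.hom t₀.pt t₀.isClosed_pt).op) with heI
  have heIhom : eI.hom = Spec.map t₀.resHom := by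
    rw [ComplexPoints.resHom_eq t₀]; rfl
  have heh : eI.hom ≫ h = t₀.left := by
    rw [heIhom]
    exact (T.left.SpecToEquivOfField ℂ).symm_apply_apply t₀.left
  -- the comparison isomorphism `Y ≅ F` over `W`
  set δ : pullback f.left h ⟶ (fiberOver f t₀).left :=
    pullback.lift (pullback.fst f.left h) (pullback.snd f.left h ≫ eI.inv) (by
      rw [Category.assoc, ← heh, eI.inv_hom_id_assoc]
      exact pullback.condition) with hδ
  set γ : (fiberOver f t₀).left ⟶ pullback f.left h :=
    pullback.lift ι (σ ≫ eI.hom) (by rw [Category.assoc, heh]; exact hισ) with hγ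
  have hδfst : δ ≫ ι = pullback.fst f.left h := pullback.lift_fst _ _ _
  have hδsnd : δ ≫ σ = pullback.snd f.left h ≫ eI.inv := pullback.lift_snd _ _ _
  have hγfst : γ ≫ pullback.fst f.left h = ι := pullback.lift_fst _ _ _
  have hγsnd : γ ≫ pullback.snd f.left h = σ ≫ eI.hom := pullback.lift_snd _ _ _
  have hδγ : δ ≫ γ = 𝟙 _ := by
    apply pullback.hom_ext
    · rw [Category.assoc, hγfst, hδfst, Category.id_comp]
    · rw [Category.assoc, hγsnd, ← Category.assoc, hδsnd, Category.assoc, eI.inv_hom_id,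
        Category.comp_id, Category.id_comp]
  have hγδ : γ ≫ δ = 𝟙 _ := by
    apply pullback.hom_ext
    · change (γ ≫ δ) ≫ ι = 𝟙 _ ≫ ι
      rw [Category.assoc, hδfst, hγfst, Category.id_comp]
    · change (γ ≫ δ) ≫ σ = 𝟙 _ ≫ σ
      rw [Category.assoc, hδsnd, ← Category.assoc, hγsnd, Category.assoc, eI.hom_inv_id,
        Category.comp_id, Category.id_comp]
  haveI : IsIso γ := ⟨⟨δ, hγδ, hδγ⟩⟩
  -- the open `U₀ = W ∖ (W_{t₀} ∖ φ(Vx))` and the point `x = ι (φ v) ∈ U₀`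
  set C₀ : Set W.left := ι.base '' (Set.range φ.left.base)ᶜ with hC₀
  have hC₀c : IsClosed C₀ :=
    ι.isClosedEmbedding.isClosedMap _ φ.left.isOpenEmbedding.isOpen_range.isClosed_compl
  set U₀ : W.left.Opens := ⟨C₀ᶜ, hC₀c.isOpen_compl⟩ with hU₀
  have hxU₀ : ι.base (φ.left.base v) ∈ U₀ := by
    rintro ⟨w, hw, hwx⟩
    exact hw ⟨v, ι.isClosedEmbedding.injective hwx.symm⟩
  set f₀ : ↑U₀ ⟶ T.left := U₀.ι ≫ f.left with hf₀
  set x' : ↥U₀ := ⟨ι.base (φ.left.base v), hxU₀⟩ with hx'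
  -- `x ∈ sm(f)` iff `x' ∈ sm(f₀)`
  suffices hsuff : (x' : ↑U₀) ∈ f₀.smoothLocus by
    have h1 : (x' : ↑U₀) ∈ U₀.ι ⁻¹ᵁ f.left.smoothLocus := by
      rw [Scheme.Hom.preimage_smoothLocus_eq]; exact hsuff
    exact h1
  -- `f₀ x' = y₀`
  have hfx : f₀.base x' = y₀ := by
    change (ι ≫ f.left).base (φ.left.base v) = t₀.pt
    rw [hισ, Scheme.Hom.comp_apply]
    haveI : Subsingleton ↥(specOver ℂ ℂ).left :=
      inferInstanceAs (Subsingleton (PrimeSpectrum ℂ))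
    have hpt : σ.base (φ.left.base v) = IsLocalRing.closedPoint ℂ := Subsingleton.elim _ _
    change t₀.left.base (σ.base (φ.left.base v)) = t₀.pt
    rw [hpt]
    rfl
  refine Literature.AlgebraicGeometry.Morphisms.mem_smoothLocus_of_flat_stalkMap_of_smooth_fiber f₀
    (Flat.stalkMap f₀ x') ?_
  rw [hfx]
  -- `f₀.fiberToSpecResidueField y₀ = α.inv ≫ β ≫ g`
  set g : pullback f.left h ⟶ Spec (T.left.residueField y₀) := pullback.snd f.left h with hg
  set β : pullback U₀.ι (pullback.fst f.left h) ⟶ pullback f.left h :=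
    pullback.snd U₀.ι (pullback.fst f.left h) with hβ
  have hfac : f₀.fiberToSpecResidueField y₀ =
      (pullbackRightPullbackFstIso f.left h U₀.ι).inv ≫ β ≫ g := by
    rw [Scheme.Hom.fiberToSpecResidueField, ← pullbackRightPullbackFstIso_inv_snd_snd]
  rw [hfac]
  -- the open immersions `β` and `θ = φ ≫ γ` into `Y` have the same range
  set θ : Vx.left ⟶ pullback f.left h := φ.left ≫ γ with hθ
  haveI : IsOpenImmersion θ := IsOpenImmersion.comp _ _
  have hrange : Set.range β.base = Set.range θ.base := by
    rw [hβ, Scheme.Pullback.range_snd, Scheme.Opens.range_ι]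
    ext z
    constructor
    · intro hz
      -- `fst z ∈ U₀` forces `δ z ∈ φ(Vx)`
      have hz' : ι.base (δ.base z) ∈ (U₀ : Set W.left) := by
        have h1 : ι.base (δ.base z) = (pullback.fst f.left h).base z := by
          rw [← Scheme.Hom.comp_apply, hδfst]
        rw [h1]
        exact hz
      by_contra hzθ
      apply hz'
      refine ⟨δ.base z, fun ⟨w, hw⟩ => hzθ ⟨w, ?_⟩, rfl⟩
      change (φ.left ≫ γ).base w = z
      rw [Scheme.Hom.comp_apply]
      change γ.base (φ.left.base w) = z
      rw [hw, ← Scheme.Hom.comp_apply, hδγ]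
      rfl
    · rintro ⟨w, rfl⟩
      change (pullback.fst f.left h).base ((φ.left ≫ γ).base w) ∈ (U₀ : Set W.left)
      rw [← Scheme.Hom.comp_apply, Category.assoc, hγfst, Scheme.Hom.comp_apply]
      rintro ⟨w', hw', hw'x⟩
      exact hw' ⟨w, ι.isClosedEmbedding.injective hw'x.symm⟩
  set κi := IsOpenImmersion.isoOfRangeEq β θ hrange with hκi
  have hκ : κi.hom ≫ θ = β := IsOpenImmersion.isoOfRangeEq_hom_fac β θ hrange
  -- `θ ≫ g = Vx.hom ≫ eI.hom`, so `β ≫ g` is smooth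
  have hφσ : φ.left ≫ σ = Vx.hom := by
    have hw := Over.w (φ ≫ fiberOverToSpec f t₀)
    rw [Literature.NumberTheory.Transcendental.specOver_self_hom] at hw
    erw [Category.comp_id] at hw
    exact hw
  have hθg : θ ≫ g = Vx.hom ≫ eI.hom := by
    rw [hθ, Category.assoc, hγsnd, ← Category.assoc, hφσ]
    rfl
  have hβg : β ≫ g = κi.hom ≫ Vx.hom ≫ eI.hom := by rw [← hκ, Category.assoc, hθg]
  rw [hβg]
  have h2 : Smooth (κi.hom ≫ Vx.hom ≫ eI.hom) := inferInstance
  have h3 : Smooth (pullbackRightPullbackFstIso f.left h U₀.ι).inv := inferInstance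
  exact MorphismProperty.comp_mem @Smooth _ _ h3 h2

end FibreCriterion

/-! ### A standard-smooth chart of fixed relative dimension about a point of the smooth locus -/

section Chart

open CategoryTheory CategoryTheory.Limits AlgebraicGeometry

/-- **About a point of its smooth locus a morphism is smooth of SOME fixed relative dimension**:
for `f : W ⟶ T` locally of finite presentation and `x ∈ sm(f)` there are an open `U ∋ x` of `W` and
`N : ℕ` with `U ⟶ T` smooth of relative dimension `N` — restrict `f` to its smooth locus (smooth),
take a standard smooth affine chart `(U', V') ∋ x` (Mathlib `Smooth.exists_isStandardSmooth`), read
off the relative dimension `N` of its presentation, and `U = V'`. [folklore] -/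
theorem exists_smoothOfRelativeDimension_of_mem_smoothLocus {W T : Scheme} (f : W ⟶ T)
    [LocallyOfFinitePresentation f] {x : W} (hx : x ∈ f.smoothLocus) :
    ∃ (U : W.Opens) (N : ℕ), x ∈ U ∧ SmoothOfRelativeDimension N (U.ι ≫ f) := by
  set S : W.Opens := f.smoothLocus with hS
  set g : ↑S ⟶ T := S.ι ≫ f with hg
  haveI : Smooth g := by
    rw [← Scheme.Hom.smoothLocus_eq_top_iff]
    have h := Scheme.Hom.preimage_smoothLocus_eq S.ι f
    rw [Scheme.Opens.ι_preimage_self] at h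
    exact h.symm
  set x' : ↥S := ⟨x, hx⟩ with hx'
  obtain ⟨U', hU', V', hV', hxV', e, hsm⟩ := Smooth.exists_isStandardSmooth g x'
  obtain ⟨N, hN⟩ := hsm.exists_isStandardSmoothOfRelativeDimension
  -- `V' ⟶ T` is smooth of relative dimension `N`: the one chart serves every point
  have hVr : (V' : (↑S : Scheme).Opens) ≤ V'.ι.opensRange := by rw [Scheme.Opens.opensRange_ι]
  haveI : IsIso (V'.ι.app V') := Scheme.Hom.isIso_app _ _ hVr
  have hsmN : SmoothOfRelativeDimension N (V'.ι ≫ g) := by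
    refine ⟨fun z => ⟨U', hU', V'.ι ⁻¹ᵁ V', hV'.preimage_of_isOpenImmersion _ hVr, z.2, ?_, ?_⟩⟩
    · intro w hw
      exact e hw
    · have hcomp : (V'.ι ≫ g).appLE U' (V'.ι ⁻¹ᵁ V') (fun w hw => e hw) =
          g.appLE U' V' e ≫ V'.ι.app V' := by
        rw [Scheme.Hom.app_eq_appLE, Scheme.Hom.appLE_comp_appLE]
      rw [hcomp, CommRingCat.hom_comp,
        RingHom.isStandardSmoothOfRelativeDimension_respectsIso.cancel_right_isIso]
      exact hN
  -- transport to the open `U = (V' ↪ S ↪ W).opensRange` of `W`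
  set u : ↑V' ⟶ W := V'.ι ≫ S.ι with hu
  refine ⟨u.opensRange, N, ⟨⟨x', hxV'⟩, rfl⟩, ?_⟩
  have hfac : u.opensRange.ι ≫ f = u.isoOpensRange.inv ≫ V'.ι ≫ g := by
    rw [← Scheme.Hom.isoOpensRange_inv_comp u, Category.assoc]
    congr 1
  rw [hfac]
  haveI := hsmN
  have h : SmoothOfRelativeDimension (0 + N) (u.isoOpensRange.inv ≫ V'.ι ≫ g) := inferInstance
  rwa [Nat.zero_add] at h

end Chart

/-! ### The item from SPREAD alone -/

section Spread

open CategoryTheory CategoryTheory.Limits AlgebraicGeometry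
open Literature.AlgebraicGeometry.Motives Literature.AlgebraicGeometry.HodgeTheory

/-- **Item stmt-HodgeConjecture-2998 ⇐ SPREAD.** The support item `SpecialisationOfAlgebraicity`
of route `LimitExtension` follows from the single classical ingredient `spread` — spreading of
algebraic supports along the family (relative Hilbert/Chow schemes, countability, flat limits over
the smooth curve; Voisin II §3.3.1, §7.3.2; Fulton 1998 §10.1): for `f : W ⟶ T` flat and proper over
a smooth irreducible curve with smooth projective `2k`-dimensional fibres off `t₀` on which the
global class `B` is algebraic, ONE Zariski-closed `𝒵 ⊆ W` off whose slices `𝒵_t` all `B_t`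
(`t ≠ t₀`) die, and whose slice over `t₀` has codimension `≥ k` in the special fibre.
Everything else is proved: the open piece `U ⊆ X` on which `g` is an open immersion is shrunk into
one standard smooth chart of `f` (fibre criterion at its points,
`mem_smoothLocus_of_isOpenImmersion_fiberOver`; `exists_smoothOfRelativeDimension_of_mem_smoothLocus`),
the `limit` theorem `restrictCompl_map_eq_zero_of_forall_ne` kills `(g ≫ ι)^* B` on `U(ℂ) ∖ 𝒵(ℂ)`,
the codimension clause of `spread` makes `U ∩ (g ≫ ι)⁻¹𝒵` a proper closed subset (`k ≥ 1`), and the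
coniveau bookkeeping `mem_supportedClasses_one_of_restrictCompl_map_eq_zero` concludes.
[cite: VoisinHodgeII2003, §3.3.1 and §7.3.2] [cite: Fulton1998, §10.1 and §20.3] -/
theorem specialisationOfAlgebraicity_of_spread
    (spread : ∀ ⦃k : ℕ⦄ ⦃T W : SchemeOver ℂ⦄ (f : W ⟶ T) (t₀ : ComplexPoints T)
      (B : complexBetti W (2 * k)),
      SmoothOfRelativeDimension 1 T.hom → IrreducibleSpace T.left → Flat f.left →
      IsProper f.left →
      (∀ t : ComplexPoints T, t ≠ t₀ → IsSmoothProjective (2 * k) (fiberOver f t) ∧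
        complexBetti.map (fiberι f t) (2 * k) B ∈ algebraicClasses (fiberOver f t) k) →
      ∃ 𝒵 : Set W.left, IsClosed 𝒵 ∧
        (∀ m : ↥(fiberOver f t₀).left, (fiberι f t₀).left.base m ∈ 𝒵 →
          (k : ℕ∞) ≤ Order.coheight m) ∧
        ∀ t : ComplexPoints T, t ≠ t₀ →
          complexBetti.restrictCompl (fiberOver f t) ((fiberι f t).left.base ⁻¹' 𝒵) (2 * k)
            (complexBetti.map (fiberι f t) (2 * k) B) = 0) :
    Summit.HodgeConjecture.HodgeConjecture.Theses.LimitExtension.SpecialisationOfAlgebraicity := by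
  unfold Summit.HodgeConjecture.HodgeConjecture.Theses.LimitExtension.SpecialisationOfAlgebraicity
  intro k X T W f t₀ g B hk hX hT hTirr hflat hprop hU hfib
  obtain ⟨U, hUne, hUg⟩ := hU
  haveI : IrreducibleSpace X.left := hX.irreducibleSpace
  haveI := hT
  haveI := hflat
  haveI := hprop
  haveI : Smooth T.hom := SmoothOfRelativeDimension.smooth 1 T.hom
  haveI : IsLocallyNoetherian T.left := LocallyOfFiniteType.isLocallyNoetherian T.hom
  haveI : LocallyOfFinitePresentation f.left :=
    Literature.AlgebraicGeometry.HodgeTheory.locallyOfFinitePresentation_of_isLocallyNoetherian f.left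
  -- the spread support
  obtain ⟨𝒵, h𝒵, hcodim, hdies⟩ := spread f t₀ B hT hTirr hflat hprop hfib
  -- a point `v₀ ∈ U`, its image `x₀ ∈ W` lies in `sm(f)` (fibre criterion) and in a chart `U'`
  obtain ⟨v₀, hv₀⟩ := hUne
  let V₁ : SchemeOver ℂ := Over.mk (U.ι ≫ X.hom)
  let j₁ : V₁ ⟶ fiberOver f t₀ := Over.homMk U.ι rfl ≫ g
  haveI : IsOpenImmersion j₁.left := hUg
  haveI : Smooth V₁.hom := by
    haveI := hX.smoothOfRelativeDimension
    haveI : Smooth X.hom := SmoothOfRelativeDimension.smooth (2 * k) X.hom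
    change Smooth (U.ι ≫ X.hom)
    infer_instance
  have hx₀ : (j₁ ≫ fiberι f t₀).left.base ⟨v₀, hv₀⟩ ∈ f.left.smoothLocus :=
    mem_smoothLocus_of_isOpenImmersion_fiberOver f t₀ j₁ ⟨v₀, hv₀⟩
  obtain ⟨U', N, hx₀U', hsmN⟩ := exists_smoothOfRelativeDimension_of_mem_smoothLocus f.left hx₀
  -- shrink the open piece: `U₂ = U ∩ (g ≫ ι)⁻¹ U'`
  set U₂ : X.left.Opens := U ⊓ (g ≫ fiberι f t₀).left ⁻¹ᵁ U' with hU₂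
  have hv₀U₂ : v₀ ∈ U₂ := ⟨hv₀, hx₀U'⟩
  let V : SchemeOver ℂ := Over.mk (U₂.ι ≫ X.hom)
  let jU : V ⟶ X := Over.homMk U₂.ι rfl
  let j : V ⟶ fiberOver f t₀ := jU ≫ g
  haveI hjU : IsOpenImmersion jU.left := inferInstanceAs (IsOpenImmersion U₂.ι)
  have hVirr : IrreducibleSpace V.left := by
    haveI : Nonempty U₂ := ⟨⟨v₀, hv₀U₂⟩⟩
    exact isIrreducible_iff_irreducibleSpace.mp
      ⟨⟨v₀, hv₀U₂⟩, (PreirreducibleSpace.isPreirreducible_univ (X := X.left)).open_subset U₂.isOpen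
        (Set.subset_univ _)⟩
  haveI : IsOpenImmersion j.left := by
    change IsOpenImmersion (U₂.ι ≫ g.left)
    rw [← Scheme.homOfLE_ι X.left (inf_le_left : U₂ ≤ U), Category.assoc]
    haveI : IsOpenImmersion (U.ι ≫ g.left) := hUg
    infer_instance
  have hrange : Set.range (j ≫ fiberι f t₀).left.base ⊆ (U' : Set W.left) := by
    rintro _ ⟨v, rfl⟩
    exact v.2.2
  -- the `limit` theorem on the shrunk piece
  have h0 := restrictCompl_map_eq_zero_of_forall_ne f t₀ j 𝒵 B hT hprop h𝒵 ⟨U', hrange, hsmN⟩ hdies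
  -- `Z₀ = (j ≫ ι)⁻¹ 𝒵` is a proper closed subset of `V` (codimension clause, `k ≥ 1`)
  have hZ₀ : IsClosed ((j ≫ fiberι f t₀).left.base ⁻¹' 𝒵) :=
    h𝒵.preimage (j ≫ fiberι f t₀).left.base.hom.continuous
  have hZ₀ne : (j ≫ fiberι f t₀).left.base ⁻¹' 𝒵 ≠ Set.univ := by
    intro huniv
    have hη : genericPoint V.left ∈ (j ≫ fiberι f t₀).left.base ⁻¹' 𝒵 := huniv ▸ Set.mem_univ _
    have hη' : (fiberι f t₀).left.base (j.left.base (genericPoint V.left)) ∈ 𝒵 := hη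
    have h1 := hcodim (j.left.base (genericPoint V.left)) hη'
    rw [coheight_eq_of_isOpenImmersion j.left,
      coheight_eq_zero_of_isGenericPoint_univ (genericPoint_spec V.left), nonpos_iff_eq_zero,
      Nat.cast_eq_zero] at h1
    exact hk.ne' h1
  have hcomp : complexBetti.map (j ≫ fiberι f t₀) (2 * k) B =
      complexBetti.map jU (2 * k) (complexBetti.map (g ≫ fiberι f t₀) (2 * k) B) := by
    rw [show j ≫ fiberι f t₀ = jU ≫ (g ≫ fiberι f t₀) from Category.assoc _ _ _,
      complexBetti.map_comp, ModuleCat.comp_apply]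
  rw [hcomp] at h0
  have hpre : (j ≫ fiberι f t₀).left.base ⁻¹' 𝒵 = jU.left.base ⁻¹' ((g ≫ fiberι f t₀).left.base ⁻¹' 𝒵) := by
    rw [← Set.preimage_comp]
    rfl
  rw [hpre] at h0 hZ₀ hZ₀ne
  exact mem_supportedClasses_one_of_restrictCompl_map_eq_zero hX jU hZ₀ hZ₀ne h0

end Spread

end Summit.HodgeConjecture.HodgeConjecture.Theorems

end
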